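import Summits.QuantumFields.YangMills.Theorems.AllWindowsColdBoxBoxHighLineGaussianColourCopies
import Summits.QuantumFields.YangMills.Theorems.AllWindowsColdBoxBoxHighLineLaplaceSandwichPauliFlat
import Summits.QuantumFields.YangMills.Theorems.AllWindowsColdBoxBoxHighLineKernelHodgeForm
import Summits.QuantumFields.YangMills.Theorems.WeakCouplingRatesColdBoxDirichletWick
import Summits.QuantumFields.YangMills.Theorems.SoftLoopLongLagDirichletLoopSurrogate

/-!
# T-S5.11b — the S5 Gaussian MAIN TERM in the edge chart: `β²·Cov_{μ₀}(c₀^{(2)}, c_T^{(2)}) = (3/4)·boxDirCircSqCov H T`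

Step (2) of the XL comparison stub S5 (LINE-19 ⟨stmt-QuantumFields-24004⟩/⟨24335⟩ `stub_landauSecondOrder`; planner ym-idea-2 g18's
`STUB-PLAN-S5-STEP2.md` §2 (⋆) and task table T-S5.11 «main term `β²Cov₀(c₀,c_T) = (3/2)K_D(T)²`, `(3/2)K_D² = (3/4)·boxDirCircSqCov H T`»),
in the letters of the planner's `TaskS5Step2Defs.lean` (edge fields `a : LandauFree H → ℝ³`, colour components `a^c = fun e => a e c` = `colour a c`,
Hodge form `Σ_c a^c·hodgeQ H·a^c` = `boxQuadForm H a` — both written UNFOLDED here, so the restatement over the Defs is `rfl`).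

* §1 transfer to the flat chart `v = ♭a : LandauFree H × Fin 3 → ℝ` (✓fcl-p3 `LaplaceSandwich.flatten`, volume preserving): the colour form is
  `v ⬝ᵥ (L ⊗ₖ 1) v` (✓`GaussianChartWick.dotProduct_kronecker_one_mulVec`), the plaquette legs `u ⬝ᵥ a^c` are the colour legs of ✓`…GaussianColourCopies`;
* §2 for ANY positive-definite `L` on ANY finite index type `I`: partition function `integral_exp_neg_colourForm`, first moment
  `integral_colourSumSq_mul_exp` (`= Z·3·(2β)⁻¹·(u⬝L⁻¹u)`), and ★`integral_colourSumSq_mul_colourSumSq_edge`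
  (`Z·∫ c_u c_w e^{−βQ} = (∫c_u e^{−βQ})(∫c_w e^{−βQ}) + Z²·(3/2)·β⁻²·(u⬝L⁻¹w)²`, `c_u(a) = Σ_c (u ⬝ᵥ a^c)²`), normalised form ★`cov_colourSumSq`
  (`E₀[c_u c_w] − E₀[c_u]E₀[c_w] = (3/2)·β⁻²·(u ⬝ᵥ L⁻¹ w)²`);
* §3 the cold box: `L = hodgeQ H` (✓`hodgeQ_posDef`), `u = landauCoeff H p₀`, `w = landauCoeff H p_T`, `p₀ = plaq12At (boxCentre H)`, `p_T` its `T·e₀`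
  translate; ✓S2 `stub_kernelHodgeForm` + ✓`integral_dirCirc_mul_eq_boxDirProjKernel` + ✓`boxDirCircSqCov_eq_two_mul_sq` turn `(3/2)K²` into
  `(3/4)·boxDirCircSqCov H T`: ★★`edgeChart_secondOrder_cov_main` — `β²·(E₀[c₀^{(2)}c_T^{(2)}] − E₀[c₀^{(2)}]E₀[c_T^{(2)}]) = (3/4)·boxDirCircSqCov H T`
  for every `H ≥ 1`, `β > 0`, `T`.

Tree only (✓GaussianColourCopies, ✓LaplaceSandwichPauliFlat, ✓KernelHodgeForm, ✓WeakCouplingRatesColdBoxDirichletWick, ✓SoftLoopLongLagDirichletLoopSurrogate)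
+ Mathlib; no definitions.  HONEST LABEL: this is the GAUSSIAN main term only (the `c^{(2)}–c^{(2)}` exchange); the corrections C1/C2, the remainder
T-S5.10/12/13, T-S5.4J, S5, U5, ⟨24004⟩ ⟨24335⟩ ⟨24336⟩ remain OPEN; route AllWindowsColdBox is DRAFT; no rung is proved; the Yang–Mills mass gap is NOT
proved by this file.  Seat ym-line-sfw-p2 g77 (LEAD, cell ym-idea-1; Wick layer T-S5.10/11).
-/

set_option autoImplicit false

noncomputable section

open MeasureTheory Matrix Finset
open scoped Kronecker
open Literature.MathematicalPhysics.QuantumFieldTheory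
open Summit.QuantumFields.YangMills.Theorems.WeakCouplingRates

namespace Summit.QuantumFields.YangMills.Theorems.AllWindowsColdBoxBoxHighLine

namespace EdgeChartGaussian

open LaplaceSandwich (flatten flatten_apply volume_preserving_flatten)
open GaussianChartWick

variable {I : Type} [Fintype I]

/-! ## §1 Transfer to the flat chart `v = ♭a : I × Fin 3 → ℝ` -/

/-- The colour form `Σ_c a^c·L·a^c` is the quadratic form of `L ⊗ₖ 1₃` in the flat variable `♭a`. -/
theorem colourForm_eq_flat (L : Matrix I I ℝ) (a : I → EuclideanSpace ℝ (Fin 3)) :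
    ∑ c : Fin 3, (fun e => a e c) ⬝ᵥ (L *ᵥ fun e => a e c) =
      flatten I a ⬝ᵥ ((L ⊗ₖ (1 : Matrix (Fin 3) (Fin 3) ℝ)) *ᵥ flatten I a) := by
  rw [dotProduct_kronecker_one_mulVec]
  rfl

/-- A plaquette leg `u ⬝ᵥ a^c` is the colour-`c` leg of `u` against `♭a`. -/
theorem leg_eq_flat (u : I → ℝ) (a : I → EuclideanSpace ℝ (Fin 3)) (c : Fin 3) :
    u ⬝ᵥ (fun e => a e c) = (fun p : I × Fin 3 => if p.2 = c then u p.1 else 0) ⬝ᵥ flatten I a := by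
  rw [colourLeg_dotProduct]
  rfl

/-- Change of variables to the flat chart (✓`volume_preserving_flatten`). -/
theorem integral_eq_flat (G : (I × Fin 3 → ℝ) → ℝ) :
    ∫ a : I → EuclideanSpace ℝ (Fin 3), G (flatten I a) = ∫ v : I × Fin 3 → ℝ, G v :=
  (volume_preserving_flatten I).integral_comp' G

/-- The three integrands of this file, moved to the flat chart at once. -/
theorem integral_legs_eq_flat (L : Matrix I I ℝ) (β : ℝ) (F : (Fin 3 → ℝ) → (Fin 3 → ℝ) → ℝ) (u w : I → ℝ) :
    ∫ a : I → EuclideanSpace ℝ (Fin 3), F (fun c => u ⬝ᵥ fun e => a e c) (fun c => w ⬝ᵥ fun e => a e c) *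
        Real.exp (-(β * ∑ c : Fin 3, (fun e => a e c) ⬝ᵥ (L *ᵥ fun e => a e c))) =
      ∫ v : I × Fin 3 → ℝ, F (fun c => (fun p : I × Fin 3 => if p.2 = c then u p.1 else 0) ⬝ᵥ v)
          (fun c => (fun p : I × Fin 3 => if p.2 = c then w p.1 else 0) ⬝ᵥ v) *
        Real.exp (-(β * (v ⬝ᵥ ((L ⊗ₖ (1 : Matrix (Fin 3) (Fin 3) ℝ)) *ᵥ v)))) := by
  rw [← integral_eq_flat]
  refine integral_congr_ae (Filter.Eventually.of_forall fun a => ?_)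
  simp only [leg_eq_flat, colourForm_eq_flat]

/-! ## §2 Moments of `exp(−β Σ_c a^c·L·a^c) da` for a positive-definite `L` -/

variable [DecidableEq I]

/-- **Partition function**: `∫ exp(−β Σ_c a^c·L·a^c) da = √(π/β)^{|I×Fin 3|}/√det(L ⊗ₖ 1)`. -/
theorem integral_exp_neg_colourForm (L : Matrix I I ℝ) (hL : L.PosDef) {β : ℝ} (hβ : 0 < β) :
    ∫ a : I → EuclideanSpace ℝ (Fin 3), Real.exp (-(β * ∑ c : Fin 3, (fun e => a e c) ⬝ᵥ (L *ᵥ fun e => a e c))) =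
      Real.sqrt (Real.pi / β) ^ Fintype.card (I × Fin 3) / Real.sqrt (L ⊗ₖ (1 : Matrix (Fin 3) (Fin 3) ℝ)).det := by
  have h := integral_legs_eq_flat L β (fun _ _ => 1) 0 0
  simp only [one_mul] at h
  rw [h, integral_exp_neg_quadForm' _ (posDef_kronecker_one L hL) hβ]

/-- The partition function, simplified: `= √(π/β)^{3|I|}/√((det L)³)`. -/
theorem integral_exp_neg_colourForm' (L : Matrix I I ℝ) (hL : L.PosDef) {β : ℝ} (hβ : 0 < β) :
    ∫ a : I → EuclideanSpace ℝ (Fin 3), Real.exp (-(β * ∑ c : Fin 3, (fun e => a e c) ⬝ᵥ (L *ᵥ fun e => a e c))) =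
      Real.sqrt (Real.pi / β) ^ (3 * Fintype.card I) / Real.sqrt (L.det ^ 3) := by
  rw [integral_exp_neg_colourForm L hL hβ, det_kronecker_one, Fintype.card_prod, Fintype.card_fin, mul_comm]

/-- The partition function is positive. -/
theorem integral_exp_neg_colourForm_pos (L : Matrix I I ℝ) (hL : L.PosDef) {β : ℝ} (hβ : 0 < β) :
    0 < ∫ a : I → EuclideanSpace ℝ (Fin 3), Real.exp (-(β * ∑ c : Fin 3, (fun e => a e c) ⬝ᵥ (L *ᵥ fun e => a e c))) := by
  rw [integral_exp_neg_colourForm L hL hβ]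
  have hP : (L ⊗ₖ (1 : Matrix (Fin 3) (Fin 3) ℝ)).PosDef := posDef_kronecker_one L hL
  exact div_pos (pow_pos (Real.sqrt_pos.2 (div_pos Real.pi_pos hβ)) _) (Real.sqrt_pos.2 hP.det_pos)

/-- **First moment** (colour-summed variance of a plaquette leg): `∫ (Σ_c (u⬝a^c)²) e^{−βQ} da = Z · (3·((2β)⁻¹·(u ⬝ᵥ L⁻¹ u)))`. -/
theorem integral_colourSumSq_mul_exp (L : Matrix I I ℝ) (hL : L.PosDef) {β : ℝ} (hβ : 0 < β) (u : I → ℝ) :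
    ∫ a : I → EuclideanSpace ℝ (Fin 3), (∑ c : Fin 3, (u ⬝ᵥ fun e => a e c) ^ 2) *
        Real.exp (-(β * ∑ c : Fin 3, (fun e => a e c) ⬝ᵥ (L *ᵥ fun e => a e c))) =
      Real.sqrt (Real.pi / β) ^ Fintype.card (I × Fin 3) / Real.sqrt (L ⊗ₖ (1 : Matrix (Fin 3) (Fin 3) ℝ)).det *
        (3 * ((2 * β)⁻¹ * (u ⬝ᵥ (L⁻¹ *ᵥ u)))) := by
  have hP : (L ⊗ₖ (1 : Matrix (Fin 3) (Fin 3) ℝ)).PosDef := posDef_kronecker_one L hL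
  have hLdet : L.det ≠ 0 := hL.det_pos.ne'
  have h := integral_legs_eq_flat L β (fun x _ => ∑ c : Fin 3, x c ^ 2) u 0
  simp only at h
  rw [h]
  have hsum : ∀ v : I × Fin 3 → ℝ,
      (∑ c : Fin 3, ((fun p : I × Fin 3 => if p.2 = c then u p.1 else 0) ⬝ᵥ v) ^ 2) *
          Real.exp (-(β * (v ⬝ᵥ ((L ⊗ₖ (1 : Matrix (Fin 3) (Fin 3) ℝ)) *ᵥ v)))) =
        ∑ c : Fin 3, ((fun p : I × Fin 3 => if p.2 = c then u p.1 else 0) ⬝ᵥ v) *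
          ((fun p : I × Fin 3 => if p.2 = c then u p.1 else 0) ⬝ᵥ v) *
          Real.exp (-(β * (v ⬝ᵥ ((L ⊗ₖ (1 : Matrix (Fin 3) (Fin 3) ℝ)) *ᵥ v)))) := by
    intro v
    rw [Finset.sum_mul]
    refine Finset.sum_congr rfl fun c _ => ?_
    rw [sq]
  simp_rw [hsum]
  rw [integral_finsetSum _ fun c _ => ?_]
  · simp_rw [integral_dotProduct_mul_dotProduct_mul_exp_quadForm' _ hP hβ,
      colourLeg_dotProduct_inv_mulVec_colourLeg L hLdet, if_true]
    rw [Finset.sum_const, Finset.card_univ, Fintype.card_fin, nsmul_eq_mul]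
    push_cast
    ring
  · have hi := integrable_sq_mul_exp_quadForm' _ hP hβ (fun p : I × Fin 3 => if p.2 = c then u p.1 else 0)
    refine hi.congr (Filter.Eventually.of_forall fun v => ?_)
    simp only [sq]

/-- ★ **T-S5.11b (general `L`)**: with `Q(a) = Σ_c a^c·L·a^c`, `Z = ∫e^{−βQ}`, `c_u(a) = Σ_c (u ⬝ᵥ a^c)²`:
`Z·∫ c_u c_w e^{−βQ} = (∫ c_u e^{−βQ})(∫ c_w e^{−βQ}) + Z²·((3/2)·(β⁻¹)²·(u ⬝ᵥ L⁻¹ w)²)` — two gluon lines, three colours, `(2β)⁻¹L⁻¹` each. -/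
theorem integral_colourSumSq_mul_colourSumSq_edge (L : Matrix I I ℝ) (hL : L.PosDef) {β : ℝ} (hβ : 0 < β) (u w : I → ℝ) :
    (∫ a : I → EuclideanSpace ℝ (Fin 3), Real.exp (-(β * ∑ c : Fin 3, (fun e => a e c) ⬝ᵥ (L *ᵥ fun e => a e c)))) *
        ∫ a : I → EuclideanSpace ℝ (Fin 3), (∑ c : Fin 3, (u ⬝ᵥ fun e => a e c) ^ 2) * (∑ c : Fin 3, (w ⬝ᵥ fun e => a e c) ^ 2) *
          Real.exp (-(β * ∑ c : Fin 3, (fun e => a e c) ⬝ᵥ (L *ᵥ fun e => a e c))) =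
      (∫ a : I → EuclideanSpace ℝ (Fin 3), (∑ c : Fin 3, (u ⬝ᵥ fun e => a e c) ^ 2) *
          Real.exp (-(β * ∑ c : Fin 3, (fun e => a e c) ⬝ᵥ (L *ᵥ fun e => a e c)))) *
        (∫ a : I → EuclideanSpace ℝ (Fin 3), (∑ c : Fin 3, (w ⬝ᵥ fun e => a e c) ^ 2) *
          Real.exp (-(β * ∑ c : Fin 3, (fun e => a e c) ⬝ᵥ (L *ᵥ fun e => a e c)))) +
      (∫ a : I → EuclideanSpace ℝ (Fin 3), Real.exp (-(β * ∑ c : Fin 3, (fun e => a e c) ⬝ᵥ (L *ᵥ fun e => a e c)))) ^ 2 *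
        (3 / 2 * (β⁻¹) ^ 2 * (u ⬝ᵥ (L⁻¹ *ᵥ w)) ^ 2) := by
  have huw := integral_legs_eq_flat L β (fun x y => (∑ c : Fin 3, x c ^ 2) * ∑ c : Fin 3, y c ^ 2) u w
  have hu := integral_legs_eq_flat L β (fun x _ => ∑ c : Fin 3, x c ^ 2) u 0
  have hw := integral_legs_eq_flat L β (fun _ y => ∑ c : Fin 3, y c ^ 2) 0 w
  simp only at huw hu hw
  rw [huw, hu, hw, integral_exp_neg_colourForm L hL hβ, integral_colourSumSq_mul_colourSumSq L hL hβ u w, Fintype.card_fin]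
  push_cast
  ring

/-- ★ **T-S5.11b, normalised** (`E₀ = Z⁻¹∫ · e^{−βQ}`): `E₀[c_u c_w] − E₀[c_u]·E₀[c_w] = (3/2)·(β⁻¹)²·(u ⬝ᵥ L⁻¹ w)²`. -/
theorem cov_colourSumSq (L : Matrix I I ℝ) (hL : L.PosDef) {β : ℝ} (hβ : 0 < β) (u w : I → ℝ) :
    (∫ a : I → EuclideanSpace ℝ (Fin 3), (∑ c : Fin 3, (u ⬝ᵥ fun e => a e c) ^ 2) * (∑ c : Fin 3, (w ⬝ᵥ fun e => a e c) ^ 2) *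
          Real.exp (-(β * ∑ c : Fin 3, (fun e => a e c) ⬝ᵥ (L *ᵥ fun e => a e c)))) /
        (∫ a : I → EuclideanSpace ℝ (Fin 3), Real.exp (-(β * ∑ c : Fin 3, (fun e => a e c) ⬝ᵥ (L *ᵥ fun e => a e c)))) -
      (∫ a : I → EuclideanSpace ℝ (Fin 3), (∑ c : Fin 3, (u ⬝ᵥ fun e => a e c) ^ 2) *
            Real.exp (-(β * ∑ c : Fin 3, (fun e => a e c) ⬝ᵥ (L *ᵥ fun e => a e c)))) /
          (∫ a : I → EuclideanSpace ℝ (Fin 3), Real.exp (-(β * ∑ c : Fin 3, (fun e => a e c) ⬝ᵥ (L *ᵥ fun e => a e c)))) *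
        ((∫ a : I → EuclideanSpace ℝ (Fin 3), (∑ c : Fin 3, (w ⬝ᵥ fun e => a e c) ^ 2) *
            Real.exp (-(β * ∑ c : Fin 3, (fun e => a e c) ⬝ᵥ (L *ᵥ fun e => a e c)))) /
          (∫ a : I → EuclideanSpace ℝ (Fin 3), Real.exp (-(β * ∑ c : Fin 3, (fun e => a e c) ⬝ᵥ (L *ᵥ fun e => a e c))))) =
      3 / 2 * (β⁻¹) ^ 2 * (u ⬝ᵥ (L⁻¹ *ᵥ w)) ^ 2 := by
  have hZ := integral_exp_neg_colourForm_pos L hL hβ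
  have h := integral_colourSumSq_mul_colourSumSq_edge L hL hβ u w
  generalize (∫ a : I → EuclideanSpace ℝ (Fin 3),
      Real.exp (-(β * ∑ c : Fin 3, (fun e => a e c) ⬝ᵥ (L *ᵥ fun e => a e c)))) = Z at hZ h ⊢
  generalize (∫ a : I → EuclideanSpace ℝ (Fin 3), (∑ c : Fin 3, (u ⬝ᵥ fun e => a e c) ^ 2) *
      (∑ c : Fin 3, (w ⬝ᵥ fun e => a e c) ^ 2) * Real.exp (-(β * ∑ c : Fin 3, (fun e => a e c) ⬝ᵥ (L *ᵥ fun e => a e c)))) = X at h ⊢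
  generalize (∫ a : I → EuclideanSpace ℝ (Fin 3), (∑ c : Fin 3, (u ⬝ᵥ fun e => a e c) ^ 2) *
      Real.exp (-(β * ∑ c : Fin 3, (fun e => a e c) ⬝ᵥ (L *ᵥ fun e => a e c)))) = U at h ⊢
  generalize (∫ a : I → EuclideanSpace ℝ (Fin 3), (∑ c : Fin 3, (w ⬝ᵥ fun e => a e c) ^ 2) *
      Real.exp (-(β * ∑ c : Fin 3, (fun e => a e c) ⬝ᵥ (L *ᵥ fun e => a e c)))) = W at h ⊢
  generalize 3 / 2 * (β⁻¹) ^ 2 * (u ⬝ᵥ (L⁻¹ *ᵥ w)) ^ 2 = κ at h ⊢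
  have hZne : Z ≠ 0 := hZ.ne'
  have hX : X = (U * W + Z ^ 2 * κ) / Z := by rw [← h, mul_div_cancel_left₀ _ hZne]
  rw [hX]
  field_simp
  ring

/-! ## §3 The cold box: `L = hodgeQ H`, legs `landauCoeff H p₀`, `landauCoeff H p_T` -/

/-- The Hodge kernel between the two Dirichlet plaquettes is the tree's `boxDirichletPlaqCov` (✓S2 + ✓`integral_dirCirc_mul_eq_boxDirProjKernel`). -/
theorem landauCoeff_hodge_kernel_eq_boxDirichletPlaqCov (H : ℕ) (hH : 1 ≤ H) (T : ℕ) :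
    landauCoeff H (plaq12At (boxCentre H)) ⬝ᵥ ((hodgeQ H)⁻¹ *ᵥ landauCoeff H (plaq12At (boxCentre H + Pi.single 0 (T : ℤ)))) =
      boxDirichletPlaqCov H T := by
  rw [← stub_kernelHodgeForm H hH, boxDirichletPlaqCov,
    Summit.QuantumFields.YangMills.Theorems.SoftLoopLongLag.integral_dirCirc_mul_eq_boxDirProjKernel]

/-- ★★ **T-S5.11 MAIN TERM in the edge chart.**  For `H ≥ 1`, `β > 0` and every `T`, with `Q(a) = Σ_c a^c·hodgeQ H·a^c` (= `boxQuadForm H a`),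
`E₀ = (∫e^{−βQ})⁻¹∫ · e^{−βQ} da` over `a : LandauFree H → ℝ³`, and the second-order plaquette costs `c_p^{(2)}(a) = Σ_c (landauCoeff H p ⬝ᵥ a^c)²`
at `p₀ = plaq12At (boxCentre H)`, `p_T = plaq12At (boxCentre H + T·e₀)`:
`β² · (E₀[c₀^{(2)} c_T^{(2)}] − E₀[c₀^{(2)}]·E₀[c_T^{(2)}]) = (3/4) · boxDirCircSqCov H T`. -/
theorem edgeChart_secondOrder_cov_main (H : ℕ) (hH : 1 ≤ H) {β : ℝ} (hβ : 0 < β) (T : ℕ) :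
    β ^ 2 *
        ((∫ a : LandauFree H → EuclideanSpace ℝ (Fin 3),
              (∑ c : Fin 3, (landauCoeff H (plaq12At (boxCentre H)) ⬝ᵥ fun e => a e c) ^ 2) *
                (∑ c : Fin 3, (landauCoeff H (plaq12At (boxCentre H + Pi.single 0 (T : ℤ))) ⬝ᵥ fun e => a e c) ^ 2) *
                Real.exp (-(β * ∑ c : Fin 3, (fun e => a e c) ⬝ᵥ (hodgeQ H *ᵥ fun e => a e c)))) /
            (∫ a : LandauFree H → EuclideanSpace ℝ (Fin 3),
              Real.exp (-(β * ∑ c : Fin 3, (fun e => a e c) ⬝ᵥ (hodgeQ H *ᵥ fun e => a e c)))) -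
          (∫ a : LandauFree H → EuclideanSpace ℝ (Fin 3),
                (∑ c : Fin 3, (landauCoeff H (plaq12At (boxCentre H)) ⬝ᵥ fun e => a e c) ^ 2) *
                  Real.exp (-(β * ∑ c : Fin 3, (fun e => a e c) ⬝ᵥ (hodgeQ H *ᵥ fun e => a e c)))) /
              (∫ a : LandauFree H → EuclideanSpace ℝ (Fin 3),
                Real.exp (-(β * ∑ c : Fin 3, (fun e => a e c) ⬝ᵥ (hodgeQ H *ᵥ fun e => a e c)))) *
            ((∫ a : LandauFree H → EuclideanSpace ℝ (Fin 3),
                (∑ c : Fin 3, (landauCoeff H (plaq12At (boxCentre H + Pi.single 0 (T : ℤ))) ⬝ᵥ fun e => a e c) ^ 2) *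
                  Real.exp (-(β * ∑ c : Fin 3, (fun e => a e c) ⬝ᵥ (hodgeQ H *ᵥ fun e => a e c)))) /
              (∫ a : LandauFree H → EuclideanSpace ℝ (Fin 3),
                Real.exp (-(β * ∑ c : Fin 3, (fun e => a e c) ⬝ᵥ (hodgeQ H *ᵥ fun e => a e c)))))) =
      3 / 4 * boxDirCircSqCov H T := by
  rw [cov_colourSumSq (hodgeQ H) (hodgeQ_posDef H) hβ, landauCoeff_hodge_kernel_eq_boxDirichletPlaqCov H hH T,
    boxDirCircSqCov_eq_two_mul_sq]
  field_simp
  ring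

end EdgeChartGaussian

end Summit.QuantumFields.YangMills.Theorems.AllWindowsColdBoxBoxHighLine

end
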